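import Literature.MathematicalPhysics.QuantumManyBody.DiluteBoseGasUpperBoundLocalization
import Literature.MathematicalPhysics.QuantumManyBody.ThermalExpectation
import Literature.MathematicalPhysics.QuantumManyBody.BoseGasFreeDirichletBEC
import Literature.MathematicalPhysics.QuantumManyBody.PeriodicBoseGasFracEnergy
import HarnessLib

/-!
# The flat-mode occupation of the Basti–Cenatiempo–Schlein cut-off state controls the torus
# condensate

Topic `Literature/MathematicalPhysics/QuantumManyBody`, companion of
`DiluteBoseGasUpperBoundLocalization.lean` ([BastiCenatiempoSchlein2021, App. A, Lemma A.1]) and of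
`BoseGasCutoffState.lean`; wanted by the crux line `reward-pays-the-wall` of
`AtomisticToContinuum/BoseEinsteinCondensation` (crux `PeriodicToDirichlet`,
stmt-AtomisticToContinuum-9483), whose registered stub `CutoffOccupation` is literally
`exists_condensateOccupation_le_occupation_cutoffState` below.

[BastiCenatiempoSchlein2021, App. A] localises an `L`-periodic `N`-body wave function `Ψ` into the
Dirichlet box `Λ_{L+2ℓ}` by the cut-off `Φ_u(X) = Ψ(X + u) ∏_{i,k} q(x_{ik})` (A.1), and Lemma A.1
records, besides `‖Φ_u‖ = 1` and the energy bound (A.2), the transport of one-body number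
observables, `⟨Φ, 𝒩ʲ Φ⟩ = ⟨Ψ, 𝒩ʲ Ψ⟩` (the one-particle density matrix of the cut-off state is
`Q γ_Ψ Q` unfolded against the partition of unity (A.3), `Q(x) = ∏ₖ q(xₖ)`). The number operator is
cut-off invariant; the **condensate** is not, and this file proves the quantitative substitute the
crux line needs (no positivity of `Ψ` is used):

* `occupation_boxConstantMode_cutoffState` — for the flat mode `φ = (L+2ℓ)^{-3/2} 1_{Λ_{L+2ℓ}}` of
  the enlarged box (`boxConstantMode`), `⟨φ, γ_{Φ₀} φ⟩ = N (L+2ℓ)⁻³ ∫_{[0,L)^{3(N-1)}} |∫ Ψ(x,Y) Q(x) dx|² dY`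
  (the weights `∏ⱼ Q(yⱼ)²` of the other particles unfold against `∑_z Q(· - Lz)² = 1`,
  `lintegral_comp_add_mul_prodWeight`);
* `condensateOccupation_le_occupation_cutoffState` — **the estimate**: for a continuous profile
  `q` with values in `[0,1]`, support in `(0, L+2ℓ)` and `∑_m q(t - Lm)² = 1` (`0 < ℓ`, `2ℓ ≤ L`;
  the profile of `exists_smooth_cutoff` qualifies) and every periodic trial state `Ψ` of `N` bosons,
  `n₀(Ψ) ≤ ((L+2ℓ)/L)³ ⟨φ, γ_{Φ₀} φ⟩ + 320 N √(ℓ/L)`, where `n₀ = condensateOccupation` is the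
  torus condensate [Fournais2020, (1.3)–(1.5)]; `exists_condensateOccupation_le_occupation_cutoffState`
  — the same with `∃ C ≥ 0` in front (the registered form).

## The argument

With `X = (x, Y)`, `n₀(Ψ) = N L⁻³ ∫_{Y ∈ [0,L)^{3(N-1)}} |∫_{[0,L)³} Ψ(x,Y) dx|² dY`
(`condensateOccupation_succ`). For fixed `Y` put `a = ∫_{[0,L)³} Ψ(·,Y)`, `p = ∫ Ψ(·,Y) Q`. The
profile equals `1` on `[2ℓ, L]` (only `m = 0` survives in the partition of unity there,
`cutoff_eq_one_of_mem`) and vanishes off `(0, L+2ℓ)`, so `1_{[0,L)³} - Q` is bounded by `1` and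
supported in the boundary layer `S = [0,L+2ℓ)³ ∖ [2ℓ,L)³` of volume `(L+2ℓ)³ - (L-2ℓ)³ ≤ 16 L² ℓ`
(`volume_cutoffLayer_le`); hence `|a| ≤ |p| + ∫_S |Ψ(·,Y)|` (`ennnorm_setIntegral_cell_le`). Squaring with
Young's inequality (`add_sq_le_young`, parameter `ε = √(ℓ/L)`) and Cauchy–Schwarz in `x`
(`setLIntegral_sq_le_volume_mul`) gives, pointwise in `Y` (`sliceMeanSq_cell_le`),
`|a|² ≤ |p|² + (ε (L+2ℓ)³ + (1 + ε⁻¹) 16 L² ℓ) ∫_{[0,2L)³} |Ψ(x,Y)|² dx`,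
and `∫_{Y ∈ [0,L)^{3(N-1)}} ∫_{[0,2L)³} |Ψ(x,Y)|² dx dY = 8` by periodicity (the doubled cell is tiled
by `8` translates of the cell, `lintegral_cellN_lintegral_doubleCell_normSq`). Multiplying by `N L⁻³`
and using `L + 2ℓ ≤ 2L`, `ε² = ℓ/L ≤ ε ≤ 1`: `n₀ ≤ ((L+2ℓ)/L)³ ⟨φ, γ_{Φ₀} φ⟩ + N (64 ε + 128 ε² + 128 ε)`.

Sanity check (free gas, `N = 1`, `Ψ ≡ L^{-3/2}`): `n₀ = 1`, `((L+2ℓ)/L)³ ⟨φ, γ_{Φ₀} φ⟩ =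
(∫ q)⁶ / L⁶ ≥ ((L-2ℓ)/L)⁶`, deficit `O(ℓ/L) ≤ C √(ℓ/L)`.

Design: theorems only (the boundary layer is a local notation); the cut-off wave function is the
raw lambda of `DiluteBoseGasUpperBoundLocalization.lean` at shift `0` (`X + fun _ => 0`), as in the
crux line's registered statements; `ℝ≥0∞` throughout. Mathlib supplies Tonelli
(`measurePreserving_piFinSuccAbove`, `lintegral_prod_symm`), Hölder
(`ENNReal.lintegral_mul_le_Lp_mul_Lq` through `lintegral_mul_sq_le`) and `measure_sdiff`.

## References

* [BastiCenatiempoSchlein2021] G. Basti, S. Cenatiempo, B. Schlein, *A new second-order upper bound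
  for the ground state energy of dilute Bose gases*, Forum Math. Sigma 9 (2021) e74
  (arXiv:2101.06222), App. A, Lemma A.1 with (A.1)–(A.3).
* [Fournais2020] S. Fournais, *Length scales for BEC in the dilute Bose gas*, arXiv:2011.00309,
  (1.3)–(1.5) (the condensate occupation `n₀`).
* [LSSY2005] E. H. Lieb, R. Seiringer, J. P. Solovej, J. Yngvason, *The Mathematics of the Bose Gas
  and its Condensation* (2005), §1.2 (1.17)–(1.19) (occupations of one-body modes).
-/

noncomputable section

namespace Literature.MathematicalPhysics.QuantumManyBody.BoseGas

open _root_.MeasureTheory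
open scoped ENNReal NNReal ComplexConjugate

variable {n : ℕ} {L : ℝ}

/-! ### Elementary inequalities -/

/-- Young's inequality for a square of a sum in `ℝ≥0∞`:
`(P + B)² ≤ (1 + ε) P² + (1 + ε⁻¹) B²` for `ε > 0`. [folklore] -/
theorem add_sq_le_young (P B : ℝ≥0∞) {ε : ℝ} (hε : 0 < ε) :
    (P + B) ^ 2 ≤ ENNReal.ofReal (1 + ε) * P ^ 2 + ENNReal.ofReal (1 + ε⁻¹) * B ^ 2 := by
  have h1 : ENNReal.ofReal (1 + ε) ≠ 0 := by
    rw [ne_eq, ENNReal.ofReal_eq_zero, not_le]; positivity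
  have h2 : ENNReal.ofReal (1 + ε⁻¹) ≠ 0 := by
    rw [ne_eq, ENNReal.ofReal_eq_zero, not_le]; positivity
  rcases eq_or_ne P ⊤ with rfl | hP
  · refine le_top.trans_eq ?_
    rw [ENNReal.top_pow two_ne_zero, ENNReal.mul_top h1, top_add]
  rcases eq_or_ne B ⊤ with rfl | hB
  · refine le_top.trans_eq ?_
    rw [ENNReal.top_pow two_ne_zero, ENNReal.mul_top h2, add_top]
  lift P to ℝ≥0 using hP
  lift B to ℝ≥0 using hB
  rw [ENNReal.ofReal, ENNReal.ofReal]
  norm_cast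
  rw [← NNReal.coe_le_coe]
  push_cast
  rw [Real.coe_toNNReal _ (by positivity), Real.coe_toNNReal _ (by positivity)]
  have hP0 : (0 : ℝ) ≤ P := P.coe_nonneg
  have hB0 : (0 : ℝ) ≤ B := B.coe_nonneg
  have key : ε * (P : ℝ) ^ 2 + ε⁻¹ * (B : ℝ) ^ 2 - 2 * P * B = ε⁻¹ * (ε * P - B) ^ 2 := by
    field_simp
    ring
  have hnn : 0 ≤ ε⁻¹ * (ε * (P : ℝ) - B) ^ 2 := mul_nonneg (inv_nonneg.2 hε.le) (sq_nonneg _)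
  nlinarith [key, hnn]

/-- Cauchy–Schwarz on a set: `(∫_T g)² ≤ |T| ∫_T g²`. [folklore] -/
theorem setLIntegral_sq_le_volume_mul (T : Set Space) {g : Space → ℝ≥0∞}
    (hg : AEMeasurable g (volume.restrict T)) :
    (∫⁻ x in T, g x) ^ 2 ≤ volume T * ∫⁻ x in T, g x ^ 2 := by
  have h := lintegral_mul_sq_le (volume.restrict T) (f := fun _ => 1) (g := g)
    aemeasurable_const hg
  simpa only [one_mul, one_pow, lintegral_const, Measure.restrict_apply_univ] using h

/-! ### Slices along the first particle and the cell -/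

/-- Adjoining the first particle commutes with translating one of the others:
`x :: (Y + eⱼ ⊗ v) = (x :: Y) + e_{j+1} ⊗ v` (a private copy of
`CouplingPathSliceFloor.vecCons_add_single`, to keep the imports light). [folklore] -/
private theorem vecCons_add_single_succ (x : Space) (Y : Config n) (j : Fin n) (v : Space) :
    (Matrix.vecCons x (Y + Pi.single j v) : Config (n + 1)) =
      Matrix.vecCons x Y + Pi.single j.succ v := by
  funext i
  refine Fin.cases ?_ (fun m => ?_) i
  · simp [Ne.symm (Fin.succ_ne_zero j)]
  · by_cases h : m = j
    · subst h; simp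
    · simp [h, Fin.succ_inj]

/-- **Eight cells.** For a normalised periodic state, the slices `x ↦ Ψ(x :: Y)` have total mass
`8` on the doubled cell `[0, 2L)³`: `∫_{Y ∈ Ω^n} ∫_{x ∈ [0,2L)³} |Ψ(x :: Y)|² = 8` (the doubled cell
is tiled by `8` translates of `Ω`, each carrying `‖Ψ‖² = 1` by periodicity). [folklore] -/
theorem lintegral_cellN_lintegral_doubleCell_normSq (hL : 0 < L) (Ψ : PeriodicTrialState (n + 1) L) :
    ∫⁻ Y in cellN n L, ∫⁻ x in cell (2 * L), (‖Ψ.ψ (Matrix.vecCons x Y)‖₊ : ℝ≥0∞) ^ 2 = 8 := by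
  have hΨc : Continuous Ψ.ψ := Ψ.contDiff.continuous
  -- each translate of the cell carries mass one
  have hone : ∀ a : Space,
      ∫⁻ Y in cellN n L, ∫⁻ x in cell L, (‖Ψ.ψ (Matrix.vecCons (x + a) Y)‖₊ : ℝ≥0∞) ^ 2 = 1 := by
    intro a
    have hvec : ∀ (x : Space) (Y : Config n),
        (Matrix.vecCons (x + a) Y : Config (n + 1)) = Matrix.vecCons x Y + Matrix.vecCons a 0 := by
      intro x Y
      rw [Matrix.cons_add_cons, add_zero]
    simp only [hvec]
    have hF : Measurable fun X : Config (n + 1) =>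
        (‖Ψ.ψ (X + Matrix.vecCons a 0)‖₊ : ℝ≥0∞) ^ 2 :=
      measurable_normSq (hΨc.comp (continuous_id.add continuous_const))
    rw [← lintegral_cellN_succ L hF,
      lintegral_cellN_comp_add hL (G := fun X => (‖Ψ.ψ X‖₊ : ℝ≥0∞) ^ 2)
        (fun X i k => by rw [Ψ.periodic]) (Matrix.vecCons a 0)]
    exact Ψ.norm_eq
  -- decompose the doubled cell into the `2³` sub-cells of side `L`
  have hsub : ∀ Y : Config n,
      ∫⁻ x in cell (2 * L), (‖Ψ.ψ (Matrix.vecCons x Y)‖₊ : ℝ≥0∞) ^ 2 =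
        ∑ c : SubIdx 2, ∫⁻ x in cell L,
          (‖Ψ.ψ (Matrix.vecCons (x + subOffset L c) Y)‖₊ : ℝ≥0∞) ^ 2 := by
    intro Y
    have hc : Continuous fun x : Space => Ψ.ψ (Matrix.vecCons x Y) := by fun_prop
    have hm : AEMeasurable (fun x : Space => (‖Ψ.ψ (Matrix.vecCons x Y)‖₊ : ℝ≥0∞) ^ 2) volume :=
      ((hc.measurable.nnnorm.coe_nnreal_ennreal).pow_const 2).aemeasurable
    have h := sum_setLIntegral_subCell (k := 2) hL hm
    push_cast at h
    rw [← h]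
    refine Finset.sum_congr rfl fun c _ => ?_
    exact (setLIntegral_cell_comp_add L (fun x => (‖Ψ.ψ (Matrix.vecCons x Y)‖₊ : ℝ≥0∞) ^ 2)
      (subOffset L c)).symm
  simp only [hsub]
  have hmeas : ∀ c : SubIdx 2, Measurable fun Y : Config n => ∫⁻ x in cell L,
      (‖Ψ.ψ (Matrix.vecCons (x + subOffset L c) Y)‖₊ : ℝ≥0∞) ^ 2 := by
    intro c
    have hc : Continuous fun p : Config n × Space =>
        Ψ.ψ (Matrix.vecCons (p.2 + subOffset L c) p.1) := by fun_prop
    have h : Measurable fun p : Config n × Space =>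
        (‖Ψ.ψ (Matrix.vecCons (p.2 + subOffset L c) p.1)‖₊ : ℝ≥0∞) ^ 2 :=
      (hc.measurable.nnnorm.coe_nnreal_ennreal).pow_const 2
    exact h.lintegral_prod_right'
  rw [lintegral_finsetSum _ fun c _ => hmeas c]
  simp only [hone, Finset.sum_const, Finset.card_univ, Fintype.card_pi, Fintype.card_fin,
    Finset.prod_const, nsmul_eq_mul, mul_one]
  norm_num

/-! ### The boundary layer of the cut-off -/

/-- A translated cell `a + [0,ℓ)³` has volume `ℓ³`. [folklore] -/
theorem volume_cellShift (ℓ : ℝ) (a : Space) : volume (cellShift ℓ a) = ENNReal.ofReal ℓ ^ 3 := by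
  have h := setLIntegral_cell_comp_add ℓ (fun _ => (1 : ℝ≥0∞)) a
  rw [setLIntegral_one, setLIntegral_one, volume_cell] at h
  exact h.symm

/-- The boundary layer is measurable. [folklore] -/
theorem measurableSet_cutoffLayer (ℓ L : ℝ) :
    MeasurableSet (cell (L + 2 * ℓ) \ cellShift (L - 2 * ℓ) (WithLp.toLp 2 fun _ : Fin 3 => 2 * ℓ)) :=
  (measurableSet_cell _).diff (measurableSet_cellShift _ _)

/-- The boundary layer lies in the enlarged cell `[0, L+2ℓ)³`. [folklore] -/
theorem cutoffLayer_subset_cell (ℓ L : ℝ) :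
    (cell (L + 2 * ℓ) \ cellShift (L - 2 * ℓ) (WithLp.toLp 2 fun _ : Fin 3 => 2 * ℓ)) ⊆
      cell (L + 2 * ℓ) :=
  Set.sdiff_subset

/-- **Volume of the boundary layer**: `|[0, L+2ℓ)³ ∖ [2ℓ, L)³| = (L+2ℓ)³ - (L-2ℓ)³ ≤ 16 L² ℓ` for
`0 < ℓ`, `2ℓ ≤ L`. [folklore] -/
theorem volume_cutoffLayer_le {ℓ L : ℝ} (hℓ : 0 < ℓ) (hℓL : 2 * ℓ ≤ L) :
    volume (cell (L + 2 * ℓ) \ cellShift (L - 2 * ℓ) (WithLp.toLp 2 fun _ : Fin 3 => 2 * ℓ)) ≤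
      ENNReal.ofReal (16 * L ^ 2 * ℓ) := by
  have hsub : cellShift (L - 2 * ℓ) (WithLp.toLp 2 fun _ : Fin 3 => 2 * ℓ) ⊆ cell (L + 2 * ℓ) := by
    intro x hx k
    rw [mem_cellShift] at hx
    obtain ⟨h1, h2⟩ := hx k
    constructor <;> linarith
  rw [measure_sdiff hsub (measurableSet_cellShift _ _).nullMeasurableSet
      (by rw [volume_cellShift]; exact ENNReal.pow_ne_top ENNReal.ofReal_ne_top),
    volume_cell, volume_cellShift, ← ENNReal.ofReal_pow (by linarith),
    ← ENNReal.ofReal_pow (by linarith), ← ENNReal.ofReal_sub _ (pow_nonneg (by linarith) 3)]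
  refine ENNReal.ofReal_le_ofReal ?_
  have h4 : 4 * ℓ ^ 2 ≤ L ^ 2 := by nlinarith
  nlinarith [mul_le_mul_of_nonneg_left h4 hℓ.le]

/-! ### The cut-off profile: plateau and support of the product weight -/

section Profile

variable {q : ℝ → ℝ} {ℓ : ℝ}

/-- **The plateau**: a profile with values in `[0, ∞)`, support in `(0, L+2ℓ)` and the partition of
unity `∑_m q(t - Lm)² = 1` equals `1` on `[2ℓ, L]` (only `m = 0` contributes there). [folklore] -/
theorem cutoff_eq_one_of_mem (hL : 0 ≤ L) (hq0 : ∀ t, 0 ≤ q t)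
    (hsupp : ∀ t, q t ≠ 0 → t ∈ Set.Ioo 0 (L + 2 * ℓ))
    (hpu : ∀ t, ∑' m : ℤ, ENNReal.ofReal (q (t - L * m) ^ 2) = 1) {t : ℝ} (h1 : 2 * ℓ ≤ t)
    (h2 : t ≤ L) : q t = 1 := by
  have hvan : ∀ m : ℤ, m ≠ 0 → ENNReal.ofReal (q (t - L * m) ^ 2) = 0 := by
    intro m hm
    have hq : q (t - L * m) = 0 := by
      by_contra h
      obtain ⟨h3, h4⟩ := hsupp _ h
      rcases lt_or_gt_of_ne hm with hm' | hm'
      · have hm1 : (m : ℝ) ≤ -1 := by exact_mod_cast (show m ≤ -1 by omega)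
        nlinarith [mul_le_mul_of_nonneg_left hm1 hL]
      · have hm1 : (1 : ℝ) ≤ m := by exact_mod_cast hm'
        nlinarith [mul_le_mul_of_nonneg_left hm1 hL]
    rw [hq, zero_pow two_ne_zero, ENNReal.ofReal_zero]
  have h := hpu t
  rw [tsum_eq_single 0 hvan] at h
  simp only [Int.cast_zero, mul_zero, sub_zero, ENNReal.ofReal_eq_one] at h
  exact (pow_eq_one_iff_of_nonneg (hq0 t) two_ne_zero).1 h

/-- The product weight `Q(x) = ∏ₖ q(xₖ)` takes values in `[0, 1]`. [folklore] -/
theorem prodCutoff_mem (hq01 : ∀ t, 0 ≤ q t ∧ q t ≤ 1) (x : Space) :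
    0 ≤ ∏ k : Fin 3, q (x k) ∧ ∏ k : Fin 3, q (x k) ≤ 1 :=
  ⟨Finset.prod_nonneg fun _ _ => (hq01 _).1,
    Finset.prod_le_one (fun _ _ => (hq01 _).1) fun _ _ => (hq01 _).2⟩

/-- The product weight vanishes off the open box `Λ_{L+2ℓ}`. [folklore] -/
theorem prodCutoff_eq_zero (hsupp : ∀ t, q t ≠ 0 → t ∈ Set.Ioo 0 (L + 2 * ℓ)) {x : Space}
    (hx : x ∉ box (L + 2 * ℓ)) : ∏ k : Fin 3, q (x k) = 0 := by
  obtain ⟨k, hk⟩ : ∃ k, x k ∉ Set.Ioo 0 (L + 2 * ℓ) := by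
    by_contra h
    push Not at h
    exact hx h
  exact Finset.prod_eq_zero (Finset.mem_univ k) (by by_contra h; exact hk (hsupp _ h))

/-- The product weight vanishes off the enlarged cell `[0, L+2ℓ)³ ⊇ Λ_{L+2ℓ}`. [folklore] -/
theorem prodCutoff_eq_zero_of_notMem_cell (hsupp : ∀ t, q t ≠ 0 → t ∈ Set.Ioo 0 (L + 2 * ℓ))
    {x : Space} (hx : x ∉ cell (L + 2 * ℓ)) : ∏ k : Fin 3, q (x k) = 0 :=
  prodCutoff_eq_zero hsupp fun h => hx fun k => Set.Ioo_subset_Ico_self (h k)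

/-- The product weight is `1` on the core `[2ℓ, L)³`. [folklore] -/
theorem prodCutoff_eq_one (hL : 0 ≤ L) (hq0 : ∀ t, 0 ≤ q t)
    (hsupp : ∀ t, q t ≠ 0 → t ∈ Set.Ioo 0 (L + 2 * ℓ))
    (hpu : ∀ t, ∑' m : ℤ, ENNReal.ofReal (q (t - L * m) ^ 2) = 1) {x : Space}
    (hx : x ∈ cellShift (L - 2 * ℓ) (WithLp.toLp 2 fun _ : Fin 3 => 2 * ℓ)) :
    ∏ k : Fin 3, q (x k) = 1 := by
  rw [mem_cellShift] at hx
  refine Finset.prod_eq_one fun k _ => ?_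
  obtain ⟨h1, h2⟩ := hx k
  exact cutoff_eq_one_of_mem hL hq0 hsupp hpu h1 (by linarith)

/-- The product weight is continuous. [folklore] -/
theorem continuous_prodCutoff (hqc : Continuous q) : Continuous fun x : Space => ∏ k : Fin 3, q (x k) := by
  fun_prop

end Profile

/-! ### The cell average of a slice against its cut-off average -/

/-- **The cell average against the cut-off average.** For a continuous `f : ℝ³ → ℂ` and an
admissible profile `q` (values in `[0,1]`, support in `(0, L+2ℓ)`, partition of unity), with
`Q(x) = ∏ₖ q(xₖ)`: `|∫_{[0,L)³} f| ≤ |∫ f Q| + ∫_{layer} |f|`, since `1_{[0,L)³} - Q` is bounded by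
`1` and supported in the boundary layer `[0, L+2ℓ)³ ∖ [2ℓ, L)³`. [folklore] -/
theorem ennnorm_setIntegral_cell_le {f : Space → ℂ} (hf : Continuous f) {q : ℝ → ℝ} {ℓ : ℝ}
    (hℓ : 0 < ℓ) (hℓL : 2 * ℓ ≤ L) (hqc : Continuous q) (hq01 : ∀ t, 0 ≤ q t ∧ q t ≤ 1)
    (hsupp : ∀ t, q t ≠ 0 → t ∈ Set.Ioo 0 (L + 2 * ℓ))
    (hpu : ∀ t, ∑' m : ℤ, ENNReal.ofReal (q (t - L * m) ^ 2) = 1) :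
    (‖∫ x in cell L, f x‖₊ : ℝ≥0∞) ≤
      ‖∫ x, f x * ((∏ k : Fin 3, q (x k) : ℝ) : ℂ)‖₊ +
        ∫⁻ x in cell (L + 2 * ℓ) \ cellShift (L - 2 * ℓ) (WithLp.toLp 2 fun _ : Fin 3 => 2 * ℓ),
          ‖f x‖₊ := by
  set S : Set Space :=
    cell (L + 2 * ℓ) \ cellShift (L - 2 * ℓ) (WithLp.toLp 2 fun _ : Fin 3 => 2 * ℓ) with hS
  have hL : 0 ≤ L := by linarith
  set Q : Space → ℝ := fun x => ∏ k : Fin 3, q (x k) with hQ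
  have hQc : Continuous Q := continuous_prodCutoff hqc
  -- integrability of the two pieces
  have hint1 : Integrable ((cell L).indicator f) :=
    (integrableOn_cell hf).integrable_indicator (measurableSet_cell L)
  have hint2 : Integrable (fun x => f x * (Q x : ℂ)) := by
    have heq : (fun x => f x * (Q x : ℂ)) =
        (cell (L + 2 * ℓ)).indicator (fun x => f x * (Q x : ℂ)) := by
      funext x
      by_cases hx : x ∈ cell (L + 2 * ℓ)
      · rw [Set.indicator_of_mem hx]
      · have hQx : Q x = 0 := prodCutoff_eq_zero_of_notMem_cell hsupp hx
        rw [Set.indicator_of_notMem hx, hQx]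
        simp
    rw [heq]
    exact (integrableOn_cell (hf.mul (Complex.continuous_ofReal.comp hQc))).integrable_indicator
      (measurableSet_cell _)
  have hsplit : ∫ x in cell L, f x =
      (∫ x, f x * (Q x : ℂ)) + ∫ x, ((cell L).indicator f x - f x * (Q x : ℂ)) := by
    rw [← integral_indicator (measurableSet_cell L), ← integral_add hint2 (hint1.sub' hint2)]
    congr 1
    funext x
    ring
  -- pointwise bound on the difference
  have hpt : ∀ x, (‖(cell L).indicator f x - f x * (Q x : ℂ)‖₊ : ℝ≥0∞) ≤
      S.indicator (fun x => (‖f x‖₊ : ℝ≥0∞)) x := by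
    intro x
    by_cases hcore : x ∈ cellShift (L - 2 * ℓ) (WithLp.toLp 2 fun _ : Fin 3 => 2 * ℓ)
    · have hQ1 : Q x = 1 := prodCutoff_eq_one hL (fun t => (hq01 t).1) hsupp hpu hcore
      have hxcell : x ∈ cell L := by
        rw [mem_cellShift] at hcore
        intro k
        obtain ⟨h1, h2⟩ := hcore k
        constructor <;> linarith
      rw [Set.indicator_of_mem hxcell, hQ1]
      simp
    by_cases hbig : x ∈ cell (L + 2 * ℓ)
    · have hmem : x ∈ S := ⟨hbig, hcore⟩
      rw [Set.indicator_of_mem hmem]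
      have hreal : ‖(cell L).indicator f x - f x * (Q x : ℂ)‖ ≤ ‖f x‖ := by
        obtain ⟨hQ0, hQ1⟩ := prodCutoff_mem hq01 x
        by_cases hx : x ∈ cell L
        · rw [Set.indicator_of_mem hx]
          have : f x - f x * (Q x : ℂ) = f x * ((1 - Q x : ℝ) : ℂ) := by push_cast; ring
          rw [this, norm_mul, Complex.norm_real, Real.norm_of_nonneg (by rw [hQ]; linarith)]
          exact mul_le_of_le_one_right (norm_nonneg _) (by rw [hQ]; linarith)
        · rw [Set.indicator_of_notMem hx, zero_sub, norm_neg, norm_mul, Complex.norm_real,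
            Real.norm_of_nonneg hQ0]
          exact mul_le_of_le_one_right (norm_nonneg _) hQ1
      exact_mod_cast hreal
    · have hxcell : x ∉ cell L := fun h => hbig fun k => ⟨(h k).1, by linarith [(h k).2]⟩
      have hQx : Q x = 0 := prodCutoff_eq_zero_of_notMem_cell hsupp hbig
      rw [Set.indicator_of_notMem hxcell, hQx]
      simp
  calc (‖∫ x in cell L, f x‖₊ : ℝ≥0∞)
      = ‖(∫ x, f x * (Q x : ℂ)) + ∫ x, ((cell L).indicator f x - f x * (Q x : ℂ))‖₊ := by
        rw [hsplit]
    _ ≤ ‖∫ x, f x * (Q x : ℂ)‖₊ + ‖∫ x, ((cell L).indicator f x - f x * (Q x : ℂ))‖₊ := by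
        exact_mod_cast nnnorm_add_le _ _
    _ ≤ ‖∫ x, f x * (Q x : ℂ)‖₊ + ∫⁻ x in S, ‖f x‖₊ := by
        gcongr
        calc (‖∫ x, ((cell L).indicator f x - f x * (Q x : ℂ))‖₊ : ℝ≥0∞)
            ≤ ∫⁻ x, ‖(cell L).indicator f x - f x * (Q x : ℂ)‖₊ :=
              enorm_integral_le_lintegral_enorm _
          _ ≤ ∫⁻ x, S.indicator (fun x => (‖f x‖₊ : ℝ≥0∞)) x := lintegral_mono hpt
          _ = ∫⁻ x in S, ‖f x‖₊ := lintegral_indicator (measurableSet_cutoffLayer ℓ L) _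

/-! ### The flat-mode occupation of the cut-off state through slices -/

/-- **The flat-mode occupation of the cut-off state.** For the Basti–Cenatiempo–Schlein cut-off
`Φ₀(X) = Ψ(X + 0) ∏_{i,k} q(x_{ik})` of an `L`-periodic `N`-body state (`N = n + 1`) and the flat
mode `φ = (L+2ℓ)^{-3/2} 1_{Λ_{L+2ℓ}}` of the enlarged box,
`⟨φ, γ_{Φ₀} φ⟩ = N (L+2ℓ)⁻³ ∫_{Y ∈ [0,L)^{3n}} |∫ Ψ(x, Y) Q(x) dx|² dY`, `Q(x) = ∏ₖ q(xₖ)`: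
`Φ₀` vanishes off the box, `Q(x) ∏ⱼ Q(yⱼ)` factors out of the `x`-integral, and the weights
`∏ⱼ Q(yⱼ)²` of the other particles are unfolded against the partition of unity `∑_z Q(· - Lz)² = 1`
(`lintegral_comp_add_mul_prodWeight`). This is the one-body transport `γ ↦ Q γ Q` of
Lemma A.1 evaluated on the flat mode. [cite: BastiCenatiempoSchlein2021, App. A, Lemma A.1] -/
theorem occupation_boxConstantMode_cutoffState (hL : 0 < L) {ℓ : ℝ} (hℓ : 0 ≤ ℓ) {q : ℝ → ℝ}
    (hqc : Continuous q) (hq0 : ∀ t, 0 ≤ q t)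
    (hsupp : ∀ t, q t ≠ 0 → t ∈ Set.Ioo 0 (L + 2 * ℓ))
    (hpu : ∀ t, ∑' m : ℤ, ENNReal.ofReal (q (t - L * m) ^ 2) = 1)
    (Ψ : PeriodicTrialState (n + 1) L) :
    occupation (n + 1) (boxConstantMode (L + 2 * ℓ)) (fun X : Config (n + 1) =>
        Ψ.ψ (X + fun _ => (0 : Space)) * ((∏ p : Fin (n + 1) × Fin 3, q (X p.1 p.2) : ℝ) : ℂ)) =
      (n + 1 : ℝ≥0∞) * ((ENNReal.ofReal (L + 2 * ℓ) ^ 3)⁻¹ *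
        ∫⁻ Y in cellN n L, (‖∫ x, Ψ.ψ (Matrix.vecCons x Y) *
          ((∏ k : Fin 3, q (x k) : ℝ) : ℂ)‖₊ : ℝ≥0∞) ^ 2) := by
  have hL' : 0 < L + 2 * ℓ := by linarith
  have hL'3 : ENNReal.ofReal (L + 2 * ℓ) ^ 3 ≠ 0 := pow_ne_zero _ (by simpa using hL')
  have h0 : (fun _ : Fin (n + 1) => (0 : Space)) = 0 := rfl
  -- the slice functional and its invariance
  set G : Config n → ℝ≥0∞ := fun Y => (‖∫ x, Ψ.ψ (Matrix.vecCons x Y) *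
    ((∏ k : Fin 3, q (x k) : ℝ) : ℂ)‖₊ : ℝ≥0∞) ^ 2 with hGdef
  have hGm : Measurable G := by
    have hc : Continuous fun p : Config n × Space =>
        Ψ.ψ (Matrix.vecCons p.2 p.1) * ((∏ k : Fin 3, q (p.2 k) : ℝ) : ℂ) := by
      have h1 : Continuous fun p : Config n × Space => Ψ.ψ (Matrix.vecCons p.2 p.1) :=
        Ψ.contDiff.continuous.comp (continuous_snd.matrixVecCons continuous_fst)
      have h2 : Continuous fun p : Config n × Space => ((∏ k : Fin 3, q (p.2 k) : ℝ) : ℂ) :=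
        Complex.continuous_ofReal.comp ((continuous_prodCutoff hqc).comp continuous_snd)
      exact h1.mul h2
    exact ((hc.stronglyMeasurable.integral_prod_right'
      (ν := (volume : Measure Space))).measurable.nnnorm.coe_nnreal_ennreal).pow_const 2
  have hGper : ∀ (Y : Config n) (j : Fin n) (k : Fin 3),
      G (Y + Pi.single j (EuclideanSpace.single k L)) = G Y := by
    intro Y j k
    simp only [hGdef, vecCons_add_single_succ, Ψ.periodic]
  have hunf := lintegral_comp_add_mul_prodWeight hL hqc hpu hGm hGper (0 : Config n)
  simp only [add_zero] at hunf
  -- pointwise in the other particles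
  have hpt : ∀ Y : Config n,
      (‖∫ x, conj (boxConstantMode (L + 2 * ℓ) x) *
          (Ψ.ψ ((Matrix.vecCons x Y : Config (n + 1)) + fun _ => (0 : Space)) *
            ((∏ p : Fin (n + 1) × Fin 3,
              q ((Matrix.vecCons x Y : Config (n + 1)) p.1 p.2) : ℝ) : ℂ))‖₊ : ℝ≥0∞) ^ 2 =
        (ENNReal.ofReal (L + 2 * ℓ) ^ 3)⁻¹ *
          (G Y * ∏ j : Fin n, ∏ k : Fin 3, ENNReal.ofReal (q (Y j k) ^ 2)) := by
    intro Y
    set W : ℝ := ∏ p : Fin n × Fin 3, q (Y p.1 p.2) with hW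
    have hW0 : 0 ≤ W := Finset.prod_nonneg fun p _ => hq0 _
    have hfun : (fun x => conj (boxConstantMode (L + 2 * ℓ) x) *
          (Ψ.ψ ((Matrix.vecCons x Y : Config (n + 1)) + fun _ => (0 : Space)) *
            ((∏ p : Fin (n + 1) × Fin 3,
              q ((Matrix.vecCons x Y : Config (n + 1)) p.1 p.2) : ℝ) : ℂ))) =
        fun x => ((Real.sqrt ((L + 2 * ℓ) ^ 3))⁻¹ : ℂ) *
          ((W : ℂ) * (Ψ.ψ (Matrix.vecCons x Y) * ((∏ k : Fin 3, q (x k) : ℝ) : ℂ))) := by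
      funext x
      have hprod : (∏ p : Fin (n + 1) × Fin 3, q ((Matrix.vecCons x Y : Config (n + 1)) p.1 p.2)) =
          (∏ k : Fin 3, q (x k)) * W := by
        rw [hW, Fintype.prod_prod_type, Fintype.prod_prod_type, Fin.prod_univ_succ]
        simp
      rw [h0, add_zero, hprod]
      by_cases hx : x ∈ box (L + 2 * ℓ)
      · simp only [boxConstantMode, Set.indicator_of_mem hx, map_inv₀, Complex.conj_ofReal]
        push_cast
        ring
      · simp only [boxConstantMode, Set.indicator_of_notMem hx, map_zero, zero_mul,
          prodCutoff_eq_zero hsupp hx]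
        simp
    rw [hfun, integral_const_mul, integral_const_mul, nnnorm_mul, ENNReal.coe_mul, mul_pow,
      nnnorm_constantMode_sq hL', ennorm_real_mul_sq W hW0, hW, ← Finset.prod_pow,
      ENNReal.ofReal_prod_of_nonneg fun p _ => sq_nonneg _, Fintype.prod_prod_type]
    ring
  simp only [occupation]
  congr 1
  calc _ = ∫⁻ Y, (ENNReal.ofReal (L + 2 * ℓ) ^ 3)⁻¹ *
        (G Y * ∏ j : Fin n, ∏ k : Fin 3, ENNReal.ofReal (q (Y j k) ^ 2)) :=
        lintegral_congr fun Y => hpt Y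
    _ = (ENNReal.ofReal (L + 2 * ℓ) ^ 3)⁻¹ *
        ∫⁻ Y, G Y * ∏ j : Fin n, ∏ k : Fin 3, ENNReal.ofReal (q (Y j k) ^ 2) :=
        lintegral_const_mul' _ _ (ENNReal.inv_ne_top.2 hL'3)
    _ = _ := by rw [hunf]

/-! ### The squared cell average against the squared cut-off average -/

/-- **Pointwise comparison of the squared averages** (expand the square, Young for the cross term,
Cauchy–Schwarz in `x`): for a continuous `f`, an admissible profile and every `ε > 0`,
`|∫_{[0,L)³} f|² ≤ |∫ f Q|² + (ε (L+2ℓ)³ + (1 + ε⁻¹) 16 L² ℓ) ∫_{[0,2L)³} |f|²`, using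
`|∫ f Q|² ≤ (L+2ℓ)³ ∫_{[0,L+2ℓ)³} |f|²`, `(∫_{layer} |f|)² ≤ |layer| ∫_{layer} |f|²`, `|layer| ≤ 16 L² ℓ`
and `[0, L+2ℓ)³ ⊆ [0, 2L)³`. [folklore] -/
theorem sliceMeanSq_cell_le {ℓ : ℝ} {q : ℝ → ℝ} (hℓ : 0 < ℓ) (hℓL : 2 * ℓ ≤ L) (hqc : Continuous q)
    (hq01 : ∀ t, 0 ≤ q t ∧ q t ≤ 1) (hsupp : ∀ t, q t ≠ 0 → t ∈ Set.Ioo 0 (L + 2 * ℓ))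
    (hpu : ∀ t, ∑' m : ℤ, ENNReal.ofReal (q (t - L * m) ^ 2) = 1) {f : Space → ℂ}
    (hf : Continuous f) {ε : ℝ} (hε : 0 < ε) :
    (‖∫ x in cell L, f x‖₊ : ℝ≥0∞) ^ 2 ≤
      (‖∫ x, f x * ((∏ k : Fin 3, q (x k) : ℝ) : ℂ)‖₊ : ℝ≥0∞) ^ 2 +
        ENNReal.ofReal (ε * (L + 2 * ℓ) ^ 3 + (1 + ε⁻¹) * (16 * L ^ 2 * ℓ)) *
          ∫⁻ x in cell (2 * L), (‖f x‖₊ : ℝ≥0∞) ^ 2 := by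
  set P : ℝ≥0∞ := ((‖∫ x, f x * ((∏ k : Fin 3, q (x k) : ℝ) : ℂ)‖₊ : ℝ≥0) : ℝ≥0∞) with hPdef
  set S : Set Space :=
    cell (L + 2 * ℓ) \ cellShift (L - 2 * ℓ) (WithLp.toLp 2 fun _ : Fin 3 => 2 * ℓ) with hS
  set B : ℝ≥0∞ := ∫⁻ x in S, ‖f x‖₊ with hBdef
  set M : ℝ≥0∞ := ∫⁻ x in cell (2 * L), (‖f x‖₊ : ℝ≥0∞) ^ 2 with hMdef
  have hL : 0 < L := by linarith
  have hL' : 0 < L + 2 * ℓ := by linarith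
  have hcell : cell (L + 2 * ℓ) ⊆ cell (2 * L) := fun x hx k =>
    ⟨(hx k).1, (hx k).2.trans_le (by linarith)⟩
  have hfm : Measurable fun x => (‖f x‖₊ : ℝ≥0∞) := hf.measurable.nnnorm.coe_nnreal_ennreal
  -- `A ≤ P + B`
  have hAPB := ennnorm_setIntegral_cell_le hf hℓ hℓL hqc hq01 hsupp hpu
  -- `B² ≤ 16 L² ℓ · M`
  have hB : B ^ 2 ≤ ENNReal.ofReal (16 * L ^ 2 * ℓ) * M := by
    calc B ^ 2 ≤ volume S * ∫⁻ x in S, (‖f x‖₊ : ℝ≥0∞) ^ 2 :=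
          setLIntegral_sq_le_volume_mul _ hfm.aemeasurable
      _ ≤ ENNReal.ofReal (16 * L ^ 2 * ℓ) * M := by
          gcongr
          · exact volume_cutoffLayer_le hℓ hℓL
          · exact lintegral_mono_set ((cutoffLayer_subset_cell ℓ L).trans hcell)
  -- `P² ≤ (L+2ℓ)³ · M`
  have hP : P ^ 2 ≤ ENNReal.ofReal (L + 2 * ℓ) ^ 3 * M := by
    have hP1 : P ≤ ∫⁻ x in cell (L + 2 * ℓ), ‖f x‖₊ := by
      calc P ≤ ∫⁻ x, ‖f x * ((∏ k : Fin 3, q (x k) : ℝ) : ℂ)‖₊ :=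
            enorm_integral_le_lintegral_enorm _
        _ ≤ ∫⁻ x, (cell (L + 2 * ℓ)).indicator (fun x => (‖f x‖₊ : ℝ≥0∞)) x := by
            refine lintegral_mono fun x => ?_
            by_cases hx : x ∈ cell (L + 2 * ℓ)
            · rw [Set.indicator_of_mem hx, nnnorm_mul, ENNReal.coe_mul]
              refine mul_le_of_le_one_right zero_le ?_
              obtain ⟨h0, h1⟩ := prodCutoff_mem hq01 x
              rw [← ENNReal.coe_one, ENNReal.coe_le_coe, ← NNReal.coe_le_coe, coe_nnnorm,
                NNReal.coe_one, Complex.norm_real, Real.norm_of_nonneg h0]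
              exact h1
            · rw [Set.indicator_of_notMem hx, prodCutoff_eq_zero_of_notMem_cell hsupp hx]
              simp
        _ = ∫⁻ x in cell (L + 2 * ℓ), ‖f x‖₊ := lintegral_indicator (measurableSet_cell _) _
    calc P ^ 2 ≤ (∫⁻ x in cell (L + 2 * ℓ), (‖f x‖₊ : ℝ≥0∞)) ^ 2 := by gcongr
      _ ≤ volume (cell (L + 2 * ℓ)) * ∫⁻ x in cell (L + 2 * ℓ), (‖f x‖₊ : ℝ≥0∞) ^ 2 :=
          setLIntegral_sq_le_volume_mul _ hfm.aemeasurable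
      _ ≤ ENNReal.ofReal (L + 2 * ℓ) ^ 3 * M := by
          rw [volume_cell]
          gcongr
          exact lintegral_mono_set hcell
  -- assemble
  have hε' : ENNReal.ofReal (1 + ε) = 1 + ENNReal.ofReal ε := by
    rw [ENNReal.ofReal_add zero_le_one hε.le, ENNReal.ofReal_one]
  calc (‖∫ x in cell L, f x‖₊ : ℝ≥0∞) ^ 2 ≤ (P + B) ^ 2 := by gcongr
    _ ≤ ENNReal.ofReal (1 + ε) * P ^ 2 + ENNReal.ofReal (1 + ε⁻¹) * B ^ 2 := add_sq_le_young P B hε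
    _ = P ^ 2 + (ENNReal.ofReal ε * P ^ 2 + ENNReal.ofReal (1 + ε⁻¹) * B ^ 2) := by
        rw [hε', add_mul, one_mul, add_assoc]
    _ ≤ P ^ 2 + (ENNReal.ofReal ε * (ENNReal.ofReal (L + 2 * ℓ) ^ 3 * M) +
          ENNReal.ofReal (1 + ε⁻¹) * (ENNReal.ofReal (16 * L ^ 2 * ℓ) * M)) := by gcongr
    _ = P ^ 2 + ENNReal.ofReal (ε * (L + 2 * ℓ) ^ 3 + (1 + ε⁻¹) * (16 * L ^ 2 * ℓ)) * M := by
        have e1 : (0 : ℝ) ≤ ε * (L + 2 * ℓ) ^ 3 := by positivity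
        have e2 : (0 : ℝ) ≤ (1 + ε⁻¹) * (16 * L ^ 2 * ℓ) := by positivity
        rw [ENNReal.ofReal_add e1 e2, ENNReal.ofReal_mul hε.le,
          ENNReal.ofReal_mul (by positivity : (0 : ℝ) ≤ 1 + ε⁻¹), ENNReal.ofReal_pow hL'.le]
        ring

/-! ### The main estimate -/

/-- **The flat-mode occupation of the cut-off state controls the torus condensate** — explicit
constant. For a continuous cut-off profile `q` on the period `L ≥ 2ℓ > 0` (values in `[0,1]`,
support in `(0, L+2ℓ)`, partition of unity `∑_m q(t - Lm)² = 1`) and every periodic trial state `Ψ`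
of `N` bosons on the torus of side `L`, the constant-mode occupation of `Ψ` is at most
`((L+2ℓ)/L)³` times the flat-mode occupation of the Basti–Cenatiempo–Schlein cut-off state
`Φ₀(X) = Ψ(X) ∏_{i,k} q(x_{ik})` in the box `Λ_{L+2ℓ}`, up to `320 N √(ℓ/L)`:
`n₀(Ψ) ≤ ((L+2ℓ)/L)³ n_φ(Φ₀) + 320 N √(ℓ/L)`.
Proof: `n₀ = N L⁻³ ∫_{cell^{N-1}} |∫_{cell} Ψ(x,Y) dx|² dY` (`condensateOccupation_succ`),
`n_φ(Φ₀) = N (L+2ℓ)⁻³ ∫_{cell^{N-1}} |∫ Ψ(x,Y) Q(x) dx|² dY`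
(`occupation_boxConstantMode_cutoffState`), the pointwise comparison `sliceMeanSq_cell_le` with
`ε = √(ℓ/L)`, and `∫_{cell^{N-1}} ∫_{[0,2L)³} |Ψ(x,Y)|² = 8`
(`lintegral_cellN_lintegral_doubleCell_normSq`); no positivity of `Ψ` is used. This is the
one-body transport of Lemma A.1 for the flat mode, which unlike `𝒩` is not cut-off invariant,
whence the boundary-layer error. [cite: BastiCenatiempoSchlein2021, App. A, Lemma A.1] -/
theorem condensateOccupation_le_occupation_cutoffState (N : ℕ) {ℓ L : ℝ} {q : ℝ → ℝ}
    (hℓ : 0 < ℓ) (hℓL : 2 * ℓ ≤ L) (hqc : Continuous q) (hq01 : ∀ t, 0 ≤ q t ∧ q t ≤ 1)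
    (hsupp : ∀ t, q t ≠ 0 → t ∈ Set.Ioo 0 (L + 2 * ℓ))
    (hpu : ∀ t, ∑' m : ℤ, ENNReal.ofReal (q (t - L * m) ^ 2) = 1) (Ψ : PeriodicTrialState N L) :
    condensateOccupation N L Ψ.ψ ≤
      ENNReal.ofReal (((L + 2 * ℓ) / L) ^ 3) *
          occupation N (boxConstantMode (L + 2 * ℓ)) (fun X : Config N =>
            Ψ.ψ (X + fun _ => (0 : Space)) * ((∏ p : Fin N × Fin 3, q (X p.1 p.2) : ℝ) : ℂ)) +
        ENNReal.ofReal (320 * N * Real.sqrt (ℓ / L)) := by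
  cases N with
  | zero => exact zero_le
  | succ n =>
    have hL : 0 < L := by linarith
    have hL' : 0 < L + 2 * ℓ := by linarith
    have hΨc : Continuous Ψ.ψ := Ψ.contDiff.continuous
    -- the small parameter
    set s : ℝ := Real.sqrt (ℓ / L) with hs
    have hs0 : 0 < s := Real.sqrt_pos.2 (div_pos hℓ hL)
    have hs2 : s ^ 2 = ℓ / L := Real.sq_sqrt (div_nonneg hℓ.le hL.le)
    have hs1 : s ≤ 1 := Real.sqrt_le_one.mpr ((div_le_one hL).2 (by linarith))
    have hk0 : 0 ≤ s * (L + 2 * ℓ) ^ 3 + (1 + s⁻¹) * (16 * L ^ 2 * ℓ) := by positivity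
    set K : ℝ≥0∞ := ENNReal.ofReal (s * (L + 2 * ℓ) ^ 3 + (1 + s⁻¹) * (16 * L ^ 2 * ℓ)) with hK
    -- integrate the pointwise comparison over the other particles
    have hMm : Measurable fun Y : Config n =>
        ∫⁻ x in cell (2 * L), (‖Ψ.ψ (Matrix.vecCons x Y)‖₊ : ℝ≥0∞) ^ 2 := by
      have h : Measurable fun p : Config n × Space =>
          (‖Ψ.ψ (Matrix.vecCons p.2 p.1)‖₊ : ℝ≥0∞) ^ 2 :=
        ((hΨc.comp (continuous_snd.matrixVecCons continuous_fst)).measurable.nnnorm.coe_nnreal_ennreal).pow_const 2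
      exact h.lintegral_prod_right'
    have hIA : ∫⁻ Y in cellN n L, (‖∫ x in cell L, Ψ.ψ (Matrix.vecCons x Y)‖₊ : ℝ≥0∞) ^ 2 ≤
        (∫⁻ Y in cellN n L, (‖∫ x, Ψ.ψ (Matrix.vecCons x Y) *
          ((∏ k : Fin 3, q (x k) : ℝ) : ℂ)‖₊ : ℝ≥0∞) ^ 2) + K * 8 := by
      have hf : ∀ Y : Config n, Continuous fun x : Space => Ψ.ψ (Matrix.vecCons x Y) := by
        intro Y; fun_prop
      calc ∫⁻ Y in cellN n L, (‖∫ x in cell L, Ψ.ψ (Matrix.vecCons x Y)‖₊ : ℝ≥0∞) ^ 2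
          ≤ ∫⁻ Y in cellN n L, ((‖∫ x, Ψ.ψ (Matrix.vecCons x Y) *
              ((∏ k : Fin 3, q (x k) : ℝ) : ℂ)‖₊ : ℝ≥0∞) ^ 2 +
                K * ∫⁻ x in cell (2 * L), (‖Ψ.ψ (Matrix.vecCons x Y)‖₊ : ℝ≥0∞) ^ 2) :=
            lintegral_mono fun Y => sliceMeanSq_cell_le hℓ hℓL hqc hq01 hsupp hpu (hf Y) hs0
        _ = (∫⁻ Y in cellN n L, (‖∫ x, Ψ.ψ (Matrix.vecCons x Y) *
              ((∏ k : Fin 3, q (x k) : ℝ) : ℂ)‖₊ : ℝ≥0∞) ^ 2) +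
              ∫⁻ Y in cellN n L, K * ∫⁻ x in cell (2 * L), (‖Ψ.ψ (Matrix.vecCons x Y)‖₊ : ℝ≥0∞) ^ 2 :=
            lintegral_add_right _ (hMm.const_mul K)
        _ = _ := by
            rw [lintegral_const_mul K hMm, lintegral_cellN_lintegral_doubleCell_normSq hL Ψ]
    -- the two occupations through slices
    rw [condensateOccupation_succ hL,
      occupation_boxConstantMode_cutoffState hL hℓ.le hqc (fun t => (hq01 t).1) hsupp hpu Ψ]
    -- scalar bookkeeping
    have hscal : (ENNReal.ofReal L ^ 3)⁻¹ =
        ENNReal.ofReal (((L + 2 * ℓ) / L) ^ 3) * (ENNReal.ofReal (L + 2 * ℓ) ^ 3)⁻¹ := by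
      rw [← ENNReal.ofReal_pow hL.le, ← ENNReal.ofReal_pow hL'.le,
        ← ENNReal.ofReal_inv_of_pos (pow_pos hL 3), ← ENNReal.ofReal_inv_of_pos (pow_pos hL' 3),
        ← ENNReal.ofReal_mul (by positivity)]
      congr 1
      field_simp
    have herr : (n + 1 : ℝ≥0∞) * ((ENNReal.ofReal L ^ 3)⁻¹ * (K * 8)) ≤
        ENNReal.ofReal (320 * ((n + 1 : ℕ) : ℝ) * s) := by
      have h8 : (8 : ℝ≥0∞) = ENNReal.ofReal 8 := by norm_num
      have hn : (n + 1 : ℝ≥0∞) = ENNReal.ofReal ((n : ℝ) + 1) := by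
        rw [ENNReal.ofReal_add n.cast_nonneg zero_le_one, ENNReal.ofReal_natCast, ENNReal.ofReal_one]
      rw [hK, h8, hn, ← ENNReal.ofReal_pow hL.le, ← ENNReal.ofReal_inv_of_pos (pow_pos hL 3),
        ← ENNReal.ofReal_mul hk0, ← ENNReal.ofReal_mul (by positivity),
        ← ENNReal.ofReal_mul (by positivity)]
      refine ENNReal.ofReal_le_ofReal ?_
      push_cast
      have hA : (L + 2 * ℓ) ^ 3 ≤ 8 * L ^ 3 := by
        calc (L + 2 * ℓ) ^ 3 ≤ (2 * L) ^ 3 := pow_le_pow_left₀ hL'.le (by linarith) 3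
          _ = 8 * L ^ 3 := by ring
      have hℓs : ℓ = s ^ 2 * L := by rw [hs2, div_mul_cancel₀ _ hL.ne']
      have h1 : s * (L + 2 * ℓ) ^ 3 ≤ 8 * s * L ^ 3 := by nlinarith
      have h2 : (1 + s⁻¹) * (16 * L ^ 2 * ℓ) = 16 * L ^ 3 * (s ^ 2 + s) := by
        rw [hℓs]; field_simp
      have h3 : s ^ 2 ≤ s := by nlinarith
      have hb : s * (L + 2 * ℓ) ^ 3 + (1 + s⁻¹) * (16 * L ^ 2 * ℓ) ≤ 40 * s * L ^ 3 := by
        nlinarith [pow_pos hL 3]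
      calc ((n : ℝ) + 1) * ((L ^ 3)⁻¹ * ((s * (L + 2 * ℓ) ^ 3 + (1 + s⁻¹) * (16 * L ^ 2 * ℓ)) * 8))
          ≤ ((n : ℝ) + 1) * ((L ^ 3)⁻¹ * ((40 * s * L ^ 3) * 8)) := by gcongr
        _ = 320 * ((n : ℝ) + 1) * s := by field_simp; ring
    -- conclusion
    calc _ ≤ (n + 1 : ℝ≥0∞) * ((ENNReal.ofReal L ^ 3)⁻¹ *
          ((∫⁻ Y in cellN n L, (‖∫ x, Ψ.ψ (Matrix.vecCons x Y) *
            ((∏ k : Fin 3, q (x k) : ℝ) : ℂ)‖₊ : ℝ≥0∞) ^ 2) + K * 8)) := by gcongr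
      _ = ENNReal.ofReal (((L + 2 * ℓ) / L) ^ 3) * ((n + 1 : ℝ≥0∞) *
            ((ENNReal.ofReal (L + 2 * ℓ) ^ 3)⁻¹ *
              ∫⁻ Y in cellN n L, (‖∫ x, Ψ.ψ (Matrix.vecCons x Y) *
                ((∏ k : Fin 3, q (x k) : ℝ) : ℂ)‖₊ : ℝ≥0∞) ^ 2)) +
          (n + 1 : ℝ≥0∞) * ((ENNReal.ofReal L ^ 3)⁻¹ * (K * 8)) := by
          rw [mul_add, mul_add, hscal]
          ring
      _ ≤ _ := by gcongr

/-- **The flat-mode occupation of the cut-off state controls the torus condensate** — the form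
registered by the crux line `reward-pays-the-wall` (`CutoffOccupation`): there is a universal
`C ≥ 0` (here `C = 320`) such that for every continuous cut-off profile `q` on the period
`L ≥ 2ℓ > 0` (values in `[0,1]`, support in `(0, L+2ℓ)`, partition of unity `∑_m q(t - Lm)² = 1`)
and every periodic trial state `Ψ` of `N` bosons on the torus of side `L`,
`n₀(Ψ) ≤ ((L+2ℓ)/L)³ n_φ(Φ₀) + C N √(ℓ/L)` with `Φ₀(X) = Ψ(X + 0) ∏_{i,k} q(x_{ik})` and `φ` the
flat mode of `Λ_{L+2ℓ}`. [cite: BastiCenatiempoSchlein2021, App. A, Lemma A.1] -/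
theorem exists_condensateOccupation_le_occupation_cutoffState :
    ∃ C : ℝ, 0 ≤ C ∧ ∀ (N : ℕ) (ℓ L : ℝ) (q : ℝ → ℝ), 0 < ℓ → 2 * ℓ ≤ L → Continuous q →
      (∀ t, 0 ≤ q t ∧ q t ≤ 1) → (∀ t, q t ≠ 0 → t ∈ Set.Ioo 0 (L + 2 * ℓ)) →
      (∀ t, ∑' m : ℤ, ENNReal.ofReal (q (t - L * m) ^ 2) = 1) →
      ∀ Ψ : PeriodicTrialState N L,
        condensateOccupation N L Ψ.ψ ≤
          ENNReal.ofReal (((L + 2 * ℓ) / L) ^ 3) *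
              occupation N (boxConstantMode (L + 2 * ℓ)) (fun X : Config N =>
                Ψ.ψ (X + fun _ => (0 : Space)) * ((∏ p : Fin N × Fin 3, q (X p.1 p.2) : ℝ) : ℂ)) +
            ENNReal.ofReal (C * N * Real.sqrt (ℓ / L)) :=
  ⟨320, by norm_num, fun N _ _ _ hℓ hℓL hqc hq01 hsupp hpu Ψ =>
    condensateOccupation_le_occupation_cutoffState N hℓ hℓL hqc hq01 hsupp hpu Ψ⟩

end Literature.MathematicalPhysics.QuantumManyBody.BoseGas

end
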